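import Literature.AnabelianGeometry.SemiGraphs.TemperedReconstructionReductions
import Literature.AnabelianGeometry.SemiGraphs.TemperedQuasiGeometricCompatible
import HarnessLib

/-!
# Corollary 3.9 and its step R2 over the COMPATIBLE reading of Definition 3.8 (additive twins)

Mochizuki, *Semi-graphs of anabelioids*, Publ. RIMS **42** (2006), §3, Definition 3.8 and
Corollary 3.9, manuscript pp. 42–43 [cite: MochizukiSemiAnbd2006, Cor 3.9 pp.42-43].  Ruling χ2
(abc-iut-L3-lead, 2026-08-25) on finding t2g2-F1: the literal reading of Def. 3.8 (the tree's FROZEN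
`IsQuasiGeometric`) admits the "fold" homomorphism, which no morphism of semi-graphs induces, so the
literal `Cor39` (TemperedReconstruction.lean, FROZEN) and its step R2 `QuasiGeometricGraphData`
(TemperedReconstructionReductions.lean, FROZEN) are refutable in principle; the cell records, WITHOUT
touching those statements, the named TWINS over the compatible reading `IsCompatiblyQuasiGeometric`
(`TemperedQuasiGeometricCompatible.lean`): `QuasiGeometricGraphDataCompat` (R2′) and `Cor39Compat`
((a) as in `Cor39`, (b) over the compatible reading) — the provisional discharge targets of the cone
node [SemiAnbd] Cor. 3.9 until the referee grades the reading.  The literal facts imply their twins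
(`quasiGeometricGraphDataCompat_of`, `cor39Compat_of`).  Statements + one-line projections only; the
reduction of `Cor39Compat` to the steps is the proof file `TemperedReconstructionCompatProofs.lean`.
Nothing here takes a side on [IUTchIII] Cor. 3.12, nor asserts either reading; typed ≠ discharged.
-/

namespace Literature.AnabelianGeometry.SemiGraphs

namespace ProfiniteSemiGraph

universe u

/-- (R2′) **Corollary 3.9, second step, over the compatible reading of Def. 3.8** ([SemiAnbd] p. 42:
"any quasi-geometric `φ : B^temp(G) → B^temp(H)` determines a map from the vertices of `G` to the
vertices of `H` … a map from the edges of `G` to the edges of `H` which is compatible with the map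
obtained above on vertices"; p. 43 "manifestly … locally open"), named residual fact, TWIN of the
frozen `QuasiGeometricGraphData` with `IsCompatiblyQuasiGeometric φ` in place of `IsQuasiGeometric φ`
(ruling χ2; finding t2g2-F1): a compatibly quasi-geometric `φ` admits a locally open morphism
`G → H` with which it is compatible. [cite: MochizukiSemiAnbd2006, Cor 3.9 pp.42-43] -/
def QuasiGeometricGraphDataCompat : Prop :=
  ∀ (𝒢 ℋ : ProfiniteSemiGraph.{u}), Cor39Hypotheses 𝒢 → Cor39Hypotheses ℋ →
    ∀ (c𝒢 : TemperedPiChart 𝒢) (cℋ : TemperedPiChart ℋ) (φ : c𝒢.G →ₜ* cℋ.G),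
      IsCompatiblyQuasiGeometric φ →
        ∃ F : Hom 𝒢 ℋ, F.IsLocallyOpen ∧ F.CompatV c𝒢 cℋ φ ∧ F.CompatE c𝒢 cℋ φ

/-- **Corollary 3.9 over the compatible reading of Def. 3.8** ([SemiAnbd] p. 42: "applying
'`B^temp(−)`' determines a natural bijective correspondence between locally open morphisms of
semi-graphs of anabelioids `G → H` and quasi-geometric morphisms of temperoids
`B^temp(G) → B^temp(H)`"), named fact, TWIN of the frozen `Cor39` (ruling χ2; finding t2g2-F1):
(a) exactly as in `Cor39` — a homomorphism induced by a locally open morphism is quasi-geometric [in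
the literal sense; that it is moreover COMPATIBLY quasi-geometric is a further claim, not recorded
here]; (b) every COMPATIBLY quasi-geometric homomorphism is induced by a locally open morphism,
unique on underlying semi-graphs. [cite: MochizukiSemiAnbd2006, Cor 3.9 p.42] -/
def Cor39Compat : Prop :=
  ∀ (𝒢 ℋ : ProfiniteSemiGraph.{u}), Cor39Hypotheses 𝒢 → Cor39Hypotheses ℋ →
    ∀ (c𝒢 : TemperedPiChart 𝒢) (cℋ : TemperedPiChart ℋ),
      (∀ (F : Hom 𝒢 ℋ), F.IsLocallyOpen → ∀ φ : c𝒢.G →ₜ* cℋ.G, F.Induces c𝒢 cℋ φ →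
        IsQuasiGeometric φ) ∧
      ∀ φ : c𝒢.G →ₜ* cℋ.G, IsCompatiblyQuasiGeometric φ →
        ∃ F : Hom 𝒢 ℋ, F.IsLocallyOpen ∧ F.Induces c𝒢 cℋ φ ∧
          ∀ F' : Hom 𝒢 ℋ, F'.IsLocallyOpen → F'.Induces c𝒢 cℋ φ →
            F'.base.vertexMap = F.base.vertexMap ∧ F'.base.edgeMap = F.base.edgeMap

/-- The literal R2 implies its twin R2′. [cite: MochizukiSemiAnbd2006, Cor 3.9 pp.42-43] -/
theorem quasiGeometricGraphDataCompat_of (h : QuasiGeometricGraphData.{u}) :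
    QuasiGeometricGraphDataCompat.{u} :=
  fun 𝒢 ℋ h𝒢 hℋ c𝒢 cℋ φ hφ => h 𝒢 ℋ h𝒢 hℋ c𝒢 cℋ φ hφ.isQuasiGeometric

/-- The literal `Cor39` implies its twin `Cor39Compat`. [cite: MochizukiSemiAnbd2006, Cor 3.9 p.42] -/
theorem cor39Compat_of (h : Cor39.{u}) : Cor39Compat.{u} :=
  fun 𝒢 ℋ h𝒢 hℋ c𝒢 cℋ =>
    ⟨(h 𝒢 ℋ h𝒢 hℋ c𝒢 cℋ).1, fun φ hφ => (h 𝒢 ℋ h𝒢 hℋ c𝒢 cℋ).2 φ hφ.isQuasiGeometric⟩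

end ProfiniteSemiGraph

end Literature.AnabelianGeometry.SemiGraphs
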